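import Summits.QuantumAdvantage.QuantumAdvantage.Theorems.LightDialA
import Summits.QuantumAdvantage.QuantumAdvantage.Theorems.IndexDialTowerCollapse
import Summits.QuantumAdvantage.QuantumAdvantage.Theorems.LightConeWindowHard

/-! # LightDialB — part 2/2 of the landing twins of NODE «LightDial» (decomp-qadv lens-2 g26; node file
`g26/LightDial.lean`, sha256 b37b6f5b9e1969d4…; generator `g26/tree/gen_twins.py`: namespace `Theses.LightDial` →
`Theorems.LightDial`, cut at the §2/§3 section boundary (node lines 312–640; REV 1), nothing else).
Content: §3 the LINEARIZATION LAW (`Idx`, `setFn`, `polyOf`, `linearization`, `linearization_surj`); §4 truncated MÖBIUS inversion on the light family (`sum_interval_neg_one_pow`, `mobius`, `setFn_mobius`) and the interpolation FLOOR `not_mem_lightLosing_of_le` / `not_lightFail_of_le` / `not_lightFail_two_two`; §5 the TENSION LAW (`altSum`, `altSum_setFn`, `altSum_lowDeg`, `parity3`, `altSum_parity3`, `parity_not_lowDeg`, `parity_not_quadratic`); §6 the light universal-hardness junction to lens-1 (`wt_xU`, `wt_xUO`, `light_universalHard_window`); §6b the tower junction to lens-5 (`tower16_of_lightCov` via `IndexDial.cell16_tower`);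 §7 census instance arithmetic. -/

set_option linter.dupNamespace false
noncomputable section
open scoped Classical

namespace Summit.QuantumAdvantage.QuantumAdvantage.Theorems.LightDial
open Finset
open Literature.Computability.QuantumComplexity Literature.Computability.QuantumComplexity.RingHLF
open Literature.Computability.MetaComplexity Literature.Computability.MetaComplexity.Smolensky
open Summit.QuantumAdvantage.AdviceFreeQNC0
open Summit.QuantumAdvantage.QuantumAdvantage.Theorems.RingPeriodFold
  (kvec kernel_pair_of_oddZeros kvec_ne_zero rel_iff_of_kernel_pair cov covStrat cov_eq_covStrat covStrat_mem_lowDeg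
   covLosing mem_covLosing losing mem_losing covNotPerfectAt_mul notPerfect_iff_aperiodic usablePeriods equivariant)
open Summit.QuantumAdvantage.QuantumAdvantage.Theorems.WildDialDoll (dot2_indicator)
open Summit.QuantumAdvantage.QuantumAdvantage.Theorems.IndexDial (cell16_tower)
open Summit.QuantumAdvantage.QuantumAdvantage.Theses.ExactnessDial (NoPerfectTwo3 NoPerfectConst3)
open Summit.QuantumAdvantage.AdviceFreeQNC0.LightConeWindowHard (window UniversalHard xU xUO xU_universalHard xUO_universalHard)

variable {n : ℕ}

/-! ## §3 LINEARIZATION LAW: on light inputs a degree-`≤ D` strategy IS a degree-`≤ D` set function -/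

/-- the index type of the monomial basis of `lowDeg F n D`. -/
abbrev Idx (n D : ℕ) : Type := {S : Finset (Fin n) // S.card ≤ D}

/-- a monomial on a light input: `x_S(ind A) = [S ⊆ A]`. -/
theorem mono_ind {F : Type*} [Field F] (S A : Finset (Fin n)) :
    mono F S (ind A) = if S ⊆ A then 1 else 0 := by
  rw [mono_apply]
  have : (∀ i ∈ S, ind A i = true) ↔ S ⊆ A := by
    simp only [ind_eq_true_iff]; rfl
  simp only [this]

/-- the degree-`≤ D` SET FUNCTION with coefficient table `c`: `A ↦ Σ_{S ⊆ A, |S| ≤ D} c_S`. -/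
def setFn {F : Type*} [Field F] {D : ℕ} (c : Idx n D → F) (A : Finset (Fin n)) : F :=
  ∑ S : Idx n D, if S.1 ⊆ A then c S else 0

/-- the polynomial with coefficient table `c`. -/
def polyOf {F : Type*} [Field F] {D : ℕ} (c : Idx n D → F) : CubeFn F n := ∑ S : Idx n D, c S • mono F S.1

/-- the polynomial of a coefficient table has degree `≤ D`. -/
theorem polyOf_mem {F : Type*} [Field F] {D : ℕ} (c : Idx n D → F) : polyOf c ∈ lowDeg F n D := by
  unfold polyOf
  exact Submodule.sum_mem _ fun S _ => Submodule.smul_mem _ _ (mono_mem_lowDeg S.2)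

/-- the polynomial of a coefficient table evaluates on `ind A` to the set function of the table. -/
theorem polyOf_ind {F : Type*} [Field F] {D : ℕ} (c : Idx n D → F) (A : Finset (Fin n)) :
    polyOf c (ind A) = setFn c A := by
  unfold polyOf setFn
  rw [Finset.sum_apply]
  refine sum_congr rfl fun S _ => ?_
  rw [Pi.smul_apply, smul_eq_mul, mono_ind]
  split_ifs <;> simp

/-- ★ LINEARIZATION LAW.  Every `P ∈ lowDeg F n D` has a coefficient table `c` on the `≤ D`-subsets with
`P(ind A) = Σ_{S ⊆ A, |S| ≤ D} c_S` for EVERY set `A`: restricted to the inputs `ind A`, a degree-`≤ D` strategy output is the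
threshold `[setFn c A = 1]` of a degree-`≤ D` set function — on the light family (`|A| ≤ w`) a point of the Johnson-scheme
module spanned by the `≤ D`-subset inclusion vectors. -/
theorem linearization {F : Type*} [Field F] {D : ℕ} {P : CubeFn F n} (hP : P ∈ lowDeg F n D) :
    ∃ c : Idx n D → F, ∀ A : Finset (Fin n), P (ind A) = setFn c A := by
  rw [lowDeg_eq_span, Submodule.mem_span_range_iff_exists_fun] at hP
  obtain ⟨c, hc⟩ := hP
  refine ⟨c, fun A => ?_⟩
  rw [← polyOf_ind, polyOf, hc]

/-- converse: every degree-`≤ D` set function is the light restriction of a degree-`≤ D` polynomial. -/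
theorem linearization_surj {F : Type*} [Field F] {D : ℕ} (c : Idx n D → F) :
    ∃ P ∈ lowDeg F n D, ∀ A : Finset (Fin n), P (ind A) = setFn c A :=
  ⟨polyOf c, polyOf_mem c, polyOf_ind c⟩

/-- every input is `ind` of its ones: the law covers all inputs, `P x = setFn c (onesOf x)`. -/
theorem linearization' {F : Type*} [Field F] {D : ℕ} {P : CubeFn F n} (hP : P ∈ lowDeg F n D) :
    ∃ c : Idx n D → F, ∀ x : Fin n → Bool, P x = setFn c (onesOf x) := by
  obtain ⟨c, hc⟩ := linearization hP
  exact ⟨c, fun x => by rw [← hc, ind_onesOf]⟩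


/-! ## §4 MÖBIUS INVERSION ON THE LIGHT FAMILY and the FLOOR of the dial (`w ≤ D`: interpolation) -/

/-- the alternating sum over the subsets of `B` (any ring): `Σ_{U ⊆ B} (-1)^{|U|} = [B = ∅]` (Mathlib over `ℤ`, cast). -/
theorem sum_neg_one_pow_card {F : Type*} [Ring F] (B : Finset (Fin n)) :
    (∑ U ∈ B.powerset, (-1 : F) ^ U.card) = if B = ∅ then 1 else 0 := by
  have h := Finset.sum_powerset_neg_one_pow_card (x := B)
  have hc : (∑ U ∈ B.powerset, (-1 : F) ^ U.card) = ((∑ U ∈ B.powerset, (-1 : ℤ) ^ U.card : ℤ) : F) := by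
    push_cast; rfl
  rw [hc, h]
  split_ifs <;> simp

/-- MÖBIUS ON AN INTERVAL of the Boolean lattice: for `T ⊆ A`, `Σ_{T ⊆ S ⊆ A} (-1)^{|S| - |T|} = [T = A]`. -/
theorem sum_interval_neg_one_pow {F : Type*} [Ring F] {T A : Finset (Fin n)} (hTA : T ⊆ A) :
    (∑ S ∈ A.powerset.filter (fun S => T ⊆ S), (-1 : F) ^ (S.card - T.card)) = if T = A then 1 else 0 := by
  have key : (∑ S ∈ A.powerset.filter (fun S => T ⊆ S), (-1 : F) ^ (S.card - T.card))
      = ∑ U ∈ (A \ T).powerset, (-1 : F) ^ U.card := by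
    refine Finset.sum_nbij' (fun S => S \ T) (fun U => T ∪ U) ?_ ?_ ?_ ?_ ?_
    · intro S hS
      simp only [mem_filter, mem_powerset] at hS
      simp only [mem_powerset]
      exact sdiff_subset_sdiff hS.1 le_rfl
    · intro U hU
      simp only [mem_powerset] at hU
      simp only [mem_filter, mem_powerset]
      exact ⟨union_subset hTA (hU.trans sdiff_subset), subset_union_left⟩
    · intro S hS
      simp only [mem_filter, mem_powerset] at hS
      exact union_sdiff_of_subset hS.2
    · intro U hU
      simp only [mem_powerset] at hU
      rw [union_sdiff_left]
      exact sdiff_eq_self_of_disjoint (sdiff_disjoint.mono_left hU)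
    · intro S hS
      simp only [mem_filter, mem_powerset] at hS
      rw [card_sdiff_of_subset hS.2]
  rw [key, sum_neg_one_pow_card]
  by_cases h : T = A
  · subst h; simp
  · have hne : A \ T ≠ ∅ := fun h0 => h (subset_antisymm hTA (sdiff_eq_empty_iff_subset.mp h0))
    rw [if_neg hne, if_neg h]

/-- the (untruncated) MÖBIUS TRANSFORM of a target set function `t`: `μt(S) = Σ_{T ⊆ S} (-1)^{|S|-|T|} t(T)`. -/
def mobiusFn {F : Type*} [Ring F] (t : Finset (Fin n) → F) (S : Finset (Fin n)) : F :=
  ∑ T ∈ S.powerset, (-1 : F) ^ (S.card - T.card) * t T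

/-- its truncation to the `≤ D`-subsets, a coefficient table. -/
def mobius {F : Type*} [Field F] {D : ℕ} (t : Finset (Fin n) → F) : Idx n D → F := fun S => mobiusFn t S.1

/-- a sum over the index type restricted to `S ⊆ A` is the sum over `A.powerset` once `|A| ≤ D` (no truncation is felt). -/
theorem sum_idx_subset {F : Type*} [AddCommMonoid F] {D : ℕ} (g : Finset (Fin n) → F) {A : Finset (Fin n)} (hA : A.card ≤ D) :
    (∑ S : Idx n D, if S.1 ⊆ A then g S.1 else 0) = ∑ S ∈ A.powerset, g S := by
  have h1 : (∑ S : Idx n D, if S.1 ⊆ A then g S.1 else 0)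
      = ∑ S ∈ (univ : Finset (Finset (Fin n))).filter (fun S => S.card ≤ D), if S ⊆ A then g S else 0 :=
    (Finset.sum_subtype (((univ : Finset (Finset (Fin n))).filter fun S => S.card ≤ D))
      (p := fun S : Finset (Fin n) => S.card ≤ D) (fun S => by simp) (fun S => if S ⊆ A then g S else 0)).symm
  rw [h1, ← Finset.sum_filter]
  refine sum_congr ?_ fun _ _ => rfl
  ext S
  simp only [mem_filter, mem_univ, true_and, mem_powerset]
  exact ⟨fun h => h.2, fun h => ⟨(card_le_card h).trans hA, h⟩⟩

/-- MÖBIUS INVERSION: `Σ_{S ⊆ A} μt(S) = t(A)`. -/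
theorem sum_powerset_mobiusFn {F : Type*} [CommRing F] (t : Finset (Fin n) → F) (A : Finset (Fin n)) :
    (∑ S ∈ A.powerset, mobiusFn t S) = t A := by
  unfold mobiusFn
  rw [Finset.sum_comm' (t' := A.powerset) (s' := fun T => A.powerset.filter fun S => T ⊆ S)]
  · have inner : ∀ T ∈ A.powerset,
        (∑ S ∈ A.powerset.filter (fun S => T ⊆ S), (-1 : F) ^ (S.card - T.card) * t T) = if T = A then t A else 0 := by
      intro T hT
      rw [← Finset.sum_mul, sum_interval_neg_one_pow (mem_powerset.mp hT)]
      split_ifs with h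
      · rw [h, one_mul]
      · rw [zero_mul]
    rw [sum_congr rfl inner, sum_ite_eq' A.powerset A (fun _ => t A), if_pos (mem_powerset.mpr le_rfl)]
  · intro S T
    simp only [mem_powerset, mem_filter]
    exact ⟨fun ⟨hS, hT⟩ => ⟨⟨hS, hT⟩, hT.trans hS⟩, fun ⟨⟨hS, hT⟩, _⟩ => ⟨hS, hT⟩⟩

/-- ★ INTERPOLATION: on every set `A` of size `≤ D` the degree-`≤ D` set function with the truncated Möbius table of `t` takes the
value `t(A)` — degree-`≤ D` polynomials take ARBITRARY prescribed values on the inputs of weight `≤ D`. -/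
theorem setFn_mobius {F : Type*} [Field F] {D : ℕ} (t : Finset (Fin n) → F) {A : Finset (Fin n)} (hA : A.card ≤ D) :
    setFn (mobius t : Idx n D → F) A = t A := by
  unfold setFn mobius
  rw [sum_idx_subset (mobiusFn t) hA, sum_powerset_mobiusFn]

/-- ★ THE FLOOR OF THE DIAL (PROVED): for `w ≤ D` and every length `n ≥ 3` there is a degree-`≤ D` strategy PERFECT on all odd-class
inputs of weight `≤ w` (interpolate any table of valid answers) — `n ∉ lightLosing D w`. -/
theorem not_mem_lightLosing_of_le {D w : ℕ} (hw : w ≤ D) (hn : 3 ≤ n) : n ∉ lightLosing D w := by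
  intro h
  have hz : ∀ A : Finset (Fin n), ∃ z : Fin n → Bool, OddZeros (ind A) → Rel (ind A) z := fun A => by
    by_cases hA : OddZeros (ind A)
    · obtain ⟨z, hz⟩ := exists_rel_of_oddZeros hn hA
      exact ⟨z, fun _ => hz⟩
    · exact ⟨fun _ => false, fun h' => absurd h' hA⟩
  choose z hz using hz
  let t : Fin n → Finset (Fin n) → ZMod 3 := fun i A => if z A i = true then 1 else 0
  let P : Fin n → CubeFn (ZMod 3) n := fun i => polyOf (mobius (t i) : Idx n D → ZMod 3)
  obtain ⟨x, hx, hxw, hR⟩ := h P fun i => polyOf_mem _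
  obtain ⟨A, rfl⟩ : ∃ A, x = ind A := ⟨onesOf x, (ind_onesOf x).symm⟩
  rw [wt_ind] at hxw
  apply hR
  have hout : (fun i => decide (P i (ind A) = 1)) = z A := by
    funext i
    have hPi : P i (ind A) = t i A := by
      show polyOf (mobius (t i) : Idx n D → ZMod 3) (ind A) = t i A
      rw [polyOf_ind, setFn_mobius _ (hxw.trans hw)]
    rw [hPi]
    cases hzi : z A i <;> simp [t, hzi]
  rw [hout]
  exact hz A hx

/-- ★ `¬ LightFail D w` for `w ≤ D`: the dial is SILENT up to the degree (census need not test `w ≤ D`). -/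
theorem not_lightFail_of_le {D w : ℕ} (hw : w ≤ D) : ¬ LightFail D w := by
  rintro ⟨n₀, h⟩
  exact not_mem_lightLosing_of_le hw (n := max n₀ 3) (le_max_right _ _) (h _ (le_max_left _ _))

/-- in particular the quadratic dial starts at `w = 3`: `¬ LightFail 2 2`. -/
theorem not_lightFail_two_two : ¬ LightFail 2 2 := not_lightFail_of_le le_rfl

/-! ## §5 THE TENSION LAW: weight PARITY is not a degree-`≤ D` set function on the `(D+1)`-light inputs -/

/-- the alternating sum of a set function over the subsets of `T` (the `|T|`-th discrete derivative at `∅`). -/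
def altSum {F : Type*} [Ring F] (T : Finset (Fin n)) (f : Finset (Fin n) → F) : F :=
  ∑ A ∈ T.powerset, (-1 : F) ^ A.card * f A

/-- a degree-`≤ D` set function has vanishing `|T|`-th derivative for `|T| > D`. -/
theorem altSum_setFn {F : Type*} [Field F] {D : ℕ} (c : Idx n D → F) {T : Finset (Fin n)} (hT : D < T.card) :
    altSum T (setFn c) = 0 := by
  unfold altSum setFn
  simp_rw [Finset.mul_sum]
  rw [Finset.sum_comm]
  refine sum_eq_zero fun S _ => ?_
  have hne : S.1 ≠ T := fun h => by have := S.2; rw [h] at this; omega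
  simp_rw [mul_ite, mul_zero]
  rw [← Finset.sum_filter]
  by_cases hST : S.1 ⊆ T
  · have e : ∀ A ∈ T.powerset.filter (fun A => S.1 ⊆ A),
        (-1 : F) ^ A.card * c S = c S * (-1 : F) ^ S.1.card * (-1 : F) ^ (A.card - S.1.card) := by
      intro A hA
      simp only [mem_filter, mem_powerset] at hA
      rw [mul_comm ((-1 : F) ^ A.card), mul_assoc, mul_comm ((-1 : F) ^ S.1.card), pow_sub_mul_pow _ (card_le_card hA.2)]
    rw [sum_congr rfl e, ← Finset.mul_sum, sum_interval_neg_one_pow hST, if_neg hne, mul_zero]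
  · rw [Finset.filter_false_of_mem, sum_empty]
    intro A hA hSA
    exact hST (hSA.trans (mem_powerset.mp hA))

/-- hence: a degree-`≤ D` polynomial has vanishing alternating sum over the light inputs below any `T` with `|T| > D`. -/
theorem altSum_lowDeg {F : Type*} [Field F] {D : ℕ} {P : CubeFn F n} (hP : P ∈ lowDeg F n D) {T : Finset (Fin n)}
    (hT : D < T.card) : altSum T (fun A => P (ind A)) = 0 := by
  obtain ⟨c, hc⟩ := linearization hP
  have : (fun A => P (ind A)) = setFn c := funext hc
  rw [this]
  exact altSum_setFn c hT

/-- weight parity as an `𝔽₃`-valued set function. -/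
def parity3 (A : Finset (Fin n)) : ZMod 3 := ((A.card % 2 : ℕ) : ZMod 3)

/-- `|A| mod 2 = 2 - 2·(-1)^{|A|}` in `𝔽₃`. -/
theorem parity3_eq (A : Finset (Fin n)) : parity3 A = 2 - 2 * (-1 : ZMod 3) ^ A.card := by
  unfold parity3
  rcases Nat.even_or_odd A.card with h | h
  · rw [Nat.even_iff.mp h, h.neg_one_pow]; decide
  · rw [Nat.odd_iff.mp h, h.neg_one_pow]; decide

/-- the alternating sum of weight parity over a nonempty `T` is `(-1)^{|T|} ≠ 0` in `𝔽₃`. -/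
theorem altSum_parity3 {T : Finset (Fin n)} (hT : T.Nonempty) : altSum T parity3 = (-1 : ZMod 3) ^ T.card := by
  unfold altSum
  have e : ∀ A : Finset (Fin n), (-1 : ZMod 3) ^ A.card * parity3 A = 2 * (-1 : ZMod 3) ^ A.card - 2 := by
    intro A
    have sq : (-1 : ZMod 3) ^ A.card * (-1 : ZMod 3) ^ A.card = 1 := by
      rw [← pow_add, ← two_mul, pow_mul, neg_one_sq, one_pow]
    rw [parity3_eq, mul_sub, ← mul_assoc, mul_comm _ (2 : ZMod 3), mul_assoc, sq]
    ring
  simp_rw [e]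
  rw [Finset.sum_sub_distrib, ← Finset.mul_sum, sum_const, card_powerset, nsmul_eq_mul]
  have h0 : (∑ A ∈ T.powerset, (-1 : ZMod 3) ^ A.card) = 0 := by
    have := congrArg (Int.cast : ℤ → ZMod 3) (Finset.sum_powerset_neg_one_pow_card_of_nonempty hT)
    push_cast at this
    exact this
  rw [h0, mul_zero, zero_sub, Nat.cast_pow, show ((2 : ℕ) : ZMod 3) = -1 by decide, show (2 : ZMod 3) = -1 by decide]
  ring

/-- ★ TENSION LAW (PROVED, every degree `D`, `n ≥ D + 1`): NO `𝔽₃`-polynomial of degree `≤ D` computes the weight PARITY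
`|A| mod 2` on the light inputs `ind A`, `|A| ≤ D + 1` — the mod-2 / mod-3 mismatch of the ring game in minimal form.  (Walk
meaning: the referee's prefix reflection-parities `u_i(ind A) = (i + 1 - |A ∩ [0,i]|) mod 2` are prefix-weight parities; a
quadratic output cannot track them past three ones.) -/
theorem parity_not_lowDeg {D : ℕ} (hn : D + 1 ≤ n) :
    ¬ ∃ P ∈ lowDeg (ZMod 3) n D, ∀ A : Finset (Fin n), A.card ≤ D + 1 → P (ind A) = parity3 A := by
  rintro ⟨P, hP, h⟩
  obtain ⟨T, -, hT⟩ : ∃ T ⊆ (univ : Finset (Fin n)), T.card = D + 1 :=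
    exists_subset_card_eq (by rw [card_univ, Fintype.card_fin]; exact hn)
  have h0 : altSum T (fun A => P (ind A)) = 0 := altSum_lowDeg hP (by omega)
  have h1 : altSum T (fun A => P (ind A)) = altSum T parity3 := by
    unfold altSum
    refine sum_congr rfl fun A hA => ?_
    dsimp only
    rw [h A ((card_le_card (mem_powerset.mp hA)).trans hT.le)]
  have h2 := altSum_parity3 (T := T) (by rw [← card_pos, hT]; omega)
  rw [h1, h2] at h0
  have sq : (-1 : ZMod 3) ^ T.card * (-1 : ZMod 3) ^ T.card = 1 := by
    rw [← pow_add, ← two_mul, pow_mul, neg_one_sq, one_pow]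
  rw [h0, mul_zero] at sq
  exact zero_ne_one sq

/-- the quadratic instance: no `𝔽₃`-quadratic computes weight parity on the inputs of weight `≤ 3` (`n ≥ 3`). -/
theorem parity_not_quadratic (hn : 3 ≤ n) :
    ¬ ∃ P ∈ lowDeg (ZMod 3) n 2, ∀ A : Finset (Fin n), A.card ≤ 3 → P (ind A) = parity3 A :=
  parity_not_lowDeg (D := 2) hn


/-! ## §6 THE LIGHT FAMILY ALREADY CARRIES HARDNESS: universal hardness against LOCAL strategies (lens-1, tree) -/

/-- weight of an input whose ones lie in a list of `ℕ`-positions is at most the list length. -/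
theorem wt_le_of_val_mem {x : Fin n → Bool} (L : List ℕ) (h : ∀ j : Fin n, x j = true → (j : ℕ) ∈ L) : wt x ≤ L.length := by
  unfold wt
  calc (univ.filter fun i : Fin n => x i = true).card ≤ L.toFinset.card := by
        refine Finset.card_le_card_of_injOn (fun j : Fin n => (j : ℕ)) (fun j hj => ?_) (Set.injOn_of_injective Fin.val_injective)
        simp only [coe_filter, mem_univ, true_and, Set.mem_setOf_eq] at hj
        simp only [mem_coe, List.mem_toFinset]
        exact h j hj
    _ ≤ L.length := List.toFinset_card_le L

/-- lens-1's uniform even family `xU` (ones at `0, 2r+1, 4r+4`) is LIGHT: weight `≤ 3`. -/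
theorem wt_xU (r n : ℕ) : wt (xU r n) ≤ 3 :=
  wt_le_of_val_mem [0, 2 * r + 1, 4 * r + 4] fun j hj => by
    simp only [xU, decide_eq_true_eq] at hj
    simp only [List.mem_cons, List.not_mem_nil, or_false]
    omega

/-- lens-1's uniform odd family `xUO` (ones at `0, 1, 2r+2, 2r+3, 4r+6, 4r+7`) is LIGHT: weight `≤ 6`. -/
theorem wt_xUO (r n : ℕ) : wt (xUO r n) ≤ 6 :=
  wt_le_of_val_mem [0, 1, 2 * r + 2, 2 * r + 3, 4 * r + 6, 4 * r + 7] fun j hj => by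
    simp only [xUO, decide_eq_true_eq] at hj
    simp only [List.mem_cons, List.not_mem_nil, or_false]
    omega

/-- ★ LIGHT UNIVERSAL HARDNESS FOR WINDOW STRATEGIES (PROVED in the tree, lens-1 `xU_universalHard` / `xUO_universalHard`;
here with the weight made explicit): for every radius `r` and every `n ≥ 6r + 9` ONE light odd-class input of weight `≤ 6` defeats
EVERY radius-`r` window strategy (any local rule, any degree, any constant advice).  The special side of the dial is not vacuous:
light inputs are exactly where locality already loses; the dial asks the same family to defeat GLOBAL low-degree strategies. -/
theorem light_universalHard_window (r n : ℕ) (hn : 6 * r + 9 ≤ n) :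
    ∃ x : Fin n → Bool, OddZeros x ∧ wt x ≤ 6 ∧ ∀ F : (Fin (2 * r + 1) → Bool) → Bool, ¬ Rel x (fun i => F (window r x i)) := by
  rcases Nat.even_or_odd n with he | ho
  · obtain ⟨k, hk⟩ := he
    obtain rfl : n = 2 * k := by omega
    exact ⟨xU r (2 * k), (xU_universalHard r k (by omega)).1, (wt_xU r _).trans (by norm_num), (xU_universalHard r k (by omega)).2⟩
  · obtain ⟨k, rfl⟩ := ho
    exact ⟨xUO r (2 * k + 1), (xUO_universalHard r k (by omega)).1, wt_xUO r _, (xUO_universalHard r k (by omega)).2⟩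

/-! ## §6b JUNCTION TO LENS-5's TOWER (tree `IndexDial.cell16_tower`) -/

/-- ★ CELL JUNCTION (lens-5 IndexDial, tree `cell16_tower`): ONE light covariant certificate at `n = 16` (the census instance
`K-LD1(2, w, 16)`: `137` trits against the light orbits only) settles covariant-quadratic non-exactness on the whole tower `16·3^j`. -/
theorem tower16_of_lightCov {w : ℕ} (h : 16 ∈ lightCovLosing 2 w) (j : ℕ) : 16 * 3 ^ j ∈ covLosing 2 :=
  cell16_tower (covLosing_of_lightCov h) j

/-! ## §7 CENSUS INSTANCE ARITHMETIC (documentation of the ask K-LD1) -/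

/-- the covariant quadratic unknowns at length `n`: `1 + n + C(n,2)` trits; at `n = 16` that is `137`. -/
theorem covQuadUnknowns_16 : 1 + 16 + Nat.choose 16 2 = 137 := by decide

/-- the light odd-class inputs of weight `≤ 5` at `n = 16` (weights `1, 3, 5`): `4944` inputs, i.e. `309` rotation orbits
(every light set of odd size `≤ 5 < 16` has trivial rotation stabiliser since `gcd`-periods would force `16 ∣ 5!`-type
divisibility — recorded informally; the census quotients by rotation itself). -/
theorem lightInputs_16_5 : Nat.choose 16 1 + Nat.choose 16 3 + Nat.choose 16 5 = 4944 ∧ 4944 = 16 * 309 := by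
  constructor <;> decide

/-- for comparison the FULL odd class at `n = 16` has `2^15 = 32768` inputs (`2048` orbits): the light instance keeps `309/2048`
of the XOR constraints and each light constraint touches at most `1 + 5 + C(5,2) = 16` of the `137` trits per output bit. -/
theorem fullOddClass_16 : 2 ^ 15 = 16 * 2048 ∧ 1 + 5 + Nat.choose 5 2 = 16 := by
  constructor <;> decide

end Summit.QuantumAdvantage.QuantumAdvantage.Theorems.LightDial
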